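import Mathlib
import Summits.ResolutionOfSingularities.ResolutionOfSingularities.Theorems.WeightedInvariantHypersurfaceLocalGameEFT3

/-!
# Door line `local-engine` (crux `HypersurfaceCentreConstruction`, stmt-ResolutionOfSingularities-19897):
# kernel seams between the clauses of H2a‴ `LocalWeightedDropEFT3 p` AS TYPED (p501595)

Theorems only (no definitions, no claims about Hironaka's problem).  Three book-keeping facts about the clause
module `Theorems/WeightedInvariantHypersurfaceLocalGameEFT3.lean`:

* `iotaTorusFactor_eq_of_essSmoothCompatible` / `iotaTorusFactorMonotone_of_essSmoothCompatible`:
  **(c11) subsumes (c10)** — the docstring claim of `IotaJEssSmoothCompatible` made kernel.  For a regular local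
  ring `(S, 𝔪)` and a prime `𝔮 ⊂ S[X]` over `𝔪`, the structure map `S → S[X]_𝔮` is a LOCAL, formally smooth,
  essentially-of-finite-type homomorphism of regular local rings (`S[X]_𝔮` is regular by Mathlib's
  `Polynomial.isRegularLocalRing_localization_atPrime_of_comap_eq_maximalIdeal`, Matsumura Thm. 19.5), so (c11)
  gives `ι (S[X]_𝔮) f = ι S f`, in particular the `≤` of (c10).  Consequence for the design (CHAIN / CRUX-PLAN
  §v6.8 only; the tree def `LocalWeightedDropEFT3` is NOT re-typed): clause (c10) of the ten-conjunct candidate is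
  derivable from clause (c11).
* `eftStrong_of_eft3`: the missing rung `LocalWeightedDropEFT3 p → LocalWeightedDropEFTStrong p` (the clause module
  has `eft_of_eft3` and `eft_of_eftStrong`; with this seam the three candidates are linearly ordered by kernel
  implications EFT3 ⇒ Strong ⇒ EFT).  Same argument as `eft_of_eft3`: successors over `𝔪·B ≤ 𝔫` are among those
  over `P·B ≤ 𝔫` since `P ≤ 𝔪`, admissibility at primes containing the positively weighted parameters follows
  from `span = P`.
* `eftCanonical_of_eft3`: projection onto `LocalWeightedDropEFTCanonical p`.

OURS, summit-side after-care of the (o16) typer of record (res-type-061); AI book-keeping, weaker than expert review.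
[L1 W4.3 · door registrar res-L1-w43-plan-1]
-/

set_option linter.dupNamespace false

noncomputable section

open IsLocalRing Literature.AlgebraicGeometry.Resolution

namespace Summit.ResolutionOfSingularities.ResolutionOfSingularities.Cruxes.HypersurfaceCentreConstruction.LocalEngine

/-! ## (c11) subsumes (c10) -/

/-- For a local ring `(S, 𝔪)` and a prime `𝔮 ⊂ S[X]` lying over `𝔪`, the structure map `S → S[X]_𝔮` is a local
homomorphism. [folklore] -/
theorem isLocalHom_algebraMap_localization_polynomial_of_comap_C (S : Type*) [CommRing S] [IsLocalRing S]
    (𝔮 : Ideal (Polynomial S)) [𝔮.IsPrime]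
    (h𝔮 : 𝔮.comap (Polynomial.C : S →+* Polynomial S) = IsLocalRing.maximalIdeal S) :
    IsLocalHom (algebraMap S (Localization.AtPrime 𝔮)) := by
  constructor
  intro a ha
  by_contra hna
  have hmem : a ∈ IsLocalRing.maximalIdeal S := hna
  rw [← h𝔮, Ideal.mem_comap] at hmem
  have hmax : algebraMap (Polynomial S) (Localization.AtPrime 𝔮) (Polynomial.C a) ∈
      IsLocalRing.maximalIdeal (Localization.AtPrime 𝔮) :=
    (IsLocalization.AtPrime.to_map_mem_maximal_iff (Localization.AtPrime 𝔮) 𝔮 (Polynomial.C a)).mpr hmem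
  rw [IsScalarTower.algebraMap_apply S (Polynomial S) (Localization.AtPrime 𝔮), Polynomial.algebraMap_eq] at ha
  exact (IsLocalRing.mem_maximalIdeal _).mp hmax ha

/-- **(c11) gives EQUALITY along the torus factor**: if `(ι, J)` is compatible with essentially smooth local
homomorphisms of regular local rings (`IotaJEssSmoothCompatible ι J`), then for every regular local `(S, 𝔪)`, `f ∈ S`
and prime `𝔮 ⊂ S[X]` over `𝔪`, `ι (S[X]_𝔮) f = ι S f` — the map `S → S[X]_𝔮` is local, formally smooth and
essentially of finite type, and `S[X]_𝔮` is a regular local ring (Mathlib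
`Polynomial.isRegularLocalRing_localization_atPrime_of_comap_eq_maximalIdeal`). [OURS · L1 W4.3, kernel] -/
theorem iotaTorusFactor_eq_of_essSmoothCompatible {ι : (R : Type) → [CommRing R] → R → Ordinal.{0}}
    {J : (R : Type) → [CommRing R] → R → ℕ → Ideal R} (hJs : IotaJEssSmoothCompatible ι J)
    (S : Type) [CommRing S] [IsRegularLocalRing S] (f : S) (𝔮 : Ideal (Polynomial S)) [𝔮.IsPrime]
    (h𝔮 : 𝔮.comap (Polynomial.C : S →+* Polynomial S) = IsLocalRing.maximalIdeal S) :
    ι (Localization.AtPrime 𝔮) (algebraMap (Polynomial S) (Localization.AtPrime 𝔮) (Polynomial.C f)) = ι S f := by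
  haveI : IsRegularLocalRing (Localization.AtPrime 𝔮) :=
    Polynomial.isRegularLocalRing_localization_atPrime_of_comap_eq_maximalIdeal S 𝔮 h𝔮
  haveI : IsLocalHom (algebraMap S (Localization.AtPrime 𝔮)) :=
    isLocalHom_algebraMap_localization_polynomial_of_comap_C S 𝔮 h𝔮
  have h := (hJs S (Localization.AtPrime 𝔮) f).1
  rw [IsScalarTower.algebraMap_apply S (Polynomial S) (Localization.AtPrime 𝔮), Polynomial.algebraMap_eq] at h
  exact h

/-- **(c11) subsumes (c10)**: `IotaJEssSmoothCompatible ι J → IotaTorusFactorMonotone ι` (the docstring claim of the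
clause module, p501595, made kernel; so clause (c10) of `LocalWeightedDropEFT3 p` is derivable from clause (c11)).
[OURS · L1 W4.3, kernel] -/
theorem iotaTorusFactorMonotone_of_essSmoothCompatible {ι : (R : Type) → [CommRing R] → R → Ordinal.{0}}
    {J : (R : Type) → [CommRing R] → R → ℕ → Ideal R} (hJs : IotaJEssSmoothCompatible ι J) :
    IotaTorusFactorMonotone ι := by
  intro S _ _ f 𝔮 _ h𝔮
  exact (iotaTorusFactor_eq_of_essSmoothCompatible hJs S f 𝔮 h𝔮).le

/-! ## The rungs EFT3 ⇒ Strong ⇒ EFT and EFT3 ⇒ Canonical -/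

/-- **The missing rung**: H2a‴ implies H2a″ (`LocalWeightedDropEFT3 p → LocalWeightedDropEFTStrong p`).  The clauses
(c7), (c8), (c6) are carried over; in the game clause the successors over `𝔪·B ≤ 𝔫` are among those over `P·B ≤ 𝔫`
(`P ≤ 𝔪`), and admissibility at a prime containing the positively weighted parameters follows from `span = P`.
[OURS · L1 W4.3, kernel] -/
theorem eftStrong_of_eft3 (p : ℕ) : LocalWeightedDropEFT3 p → LocalWeightedDropEFTStrong p := by
  rintro ⟨ι, J, hiso, hgen, husc, -, -, -, hgame, -, -, -⟩
  refine ⟨ι, hgen, husc, hiso, ?_⟩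
  intro k₀ _ _ _ S _ _ _ _ f hf0 hf2
  obtain ⟨P, hP, -, -, -, -, n, u, w, hspan, hrk, hpos, hctr, -, hadm, hsucc⟩ :=
    hgame k₀ S f hf0 hf2
  refine ⟨n, u, w, hspan, hrk, hpos, ?_, ?_⟩
  · intro P' _ hP'
    haveI := hP
    have hle : P ≤ P' := by
      rw [← hctr]
      apply Ideal.span_le.mpr
      rintro x ⟨i, hi, rfl⟩
      exact hP' i hi
    exact hadm P' hle
  · intro 𝔫 _ ht hm hv a g hfg hndvd hsing
    haveI := hP
    have hPm : P ≤ maximalIdeal S := IsLocalRing.le_maximalIdeal hP.ne_top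
    exact hsucc 𝔫 ht ((Ideal.map_mono hPm).trans hm) hv a g hfg hndvd hsing

/-- Projection: H2a‴ implies the canonical-game candidate `LocalWeightedDropEFTCanonical p` ((c6), `JIsoInvariant`,
(c9′)). [OURS · L1 W4.3, kernel] -/
theorem eftCanonical_of_eft3 (p : ℕ) : LocalWeightedDropEFT3 p → LocalWeightedDropEFTCanonical p := by
  rintro ⟨ι, J, hiso, -, -, -, hJ, -, hgame, -, -, -⟩
  exact ⟨ι, J, hiso, hJ, hgame⟩

end Summit.ResolutionOfSingularities.ResolutionOfSingularities.Cruxes.HypersurfaceCentreConstruction.LocalEngine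

end
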